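import Literature.AnabelianGeometry.EtaleTheta.Discharge.Sec2GalExtensionCocycles
import Literature.AnabelianGeometry.EtaleTheta.Discharge.Sec2ShiftNormalizesDY

/-!
# [EtTh] Prop 2.14 (ii) for the §1 model, III: the `Gal(Y/X)`-generator extension `hgal`, hence
# Prop 2.14 (ii) and Cor 2.18 (ii) for the model, conditional on Prop 1.5 (ii), (iii)

Mochizuki, *The Étale Theta Function …* [EtTh], Publ. RIMS 45 (2009), §2, Prop 2.14 (ii), PRIMS PDF
p.49 (locators `p.N` = PDF pages; bib key `MochizukiEtTh2009`). PROOF-ONLY; unit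
"deep EtTh:Prop2.14(ii)-model (hgal)" of seat abc-iut-L2-t10; continuation of
`Discharge/Sec2GalExtensionCocycles.lean`.

`Discharge/Sec2KLConjugacyProofs.lean` reduced the named fact `RigidData.Prop214_ii` to ONE input
`hgal`: for every theta cocycle `η` and `x ∈ Π^tp_X`, the difference cocycle `η · (x·η)⁻¹` on `Π^tp_Ÿ`
extends to a continuous cocycle `ρ` of `Π^tp_Y` whose shift `α_ρ` normalises `D_Y`. Here `hgal` is
PROVED for abc-iut-L2-t8's instantiation `DoubleUnderline.thetaEnvData` of the interface from the §1
theta setting (`thetaEnvData_gal_extension`), from abc-iut-L2-t1's named facts `Prop15ii`, `Prop15iii`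
([EtTh] Prop 1.5 (ii), (iii) — exactly the printed dependency, p.49) and ONE explicit hypothesis

* `H2 : ∀ t : l·Δ_Θ, t² = 1 → red t = 1` — the `2`-torsion of `l·Δ_Θ` dies in `μ_N`. It holds when `N` is
  odd (`red_eq_one_of_sq_eq_one_of_odd`), when the cyclotome is given compatibly at levels `N ∣ 2N`
  (`red_eq_one_of_sq_eq_one_of_double`; abc-iut-L2-t8's `CyclotomeTower`), and when `Δ_Θ` has no
  `2`-torsion, e.g. `Δ_Θ ≅ Ẑ(1)` (p.12; `red_eq_one_of_sq_eq_one_of_torsionfree`). The typed root axioms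
  at ONE level `N` record `Δ_Θ` only up to such torsion, and without `H2` the `D_Y`-normalisation can fail
  by a sign character of `Π^tp_Y̲̲/Π^tp_Ÿ̲̲ ≅ ℤ/2` with values in `μ_N[2]` for even `N`.

Route (p.49): `ρ := red ∘ F` for the `l·Δ_Θ`-valued descended extension `F = m(·̄)·∂e(·̄)` of part II
("`Ü²` descends to `Y`"); by `Discharge/Sec2ShiftNormalizesDY.lean` the shift `α_ρ` normalises `D_Y` once,
for every `y ∈ Π^tp_X̲̲`, the cocycle `(y·ρ)·ρ⁻¹` is INFLATED FROM `G_K` — which holds because it vanishes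
on `Δ^tp_Y̲̲` ("`Gal(Y/X)` maps `Ü²` to a `K^×`-multiple of `Ü²`": it vanishes on `Δ^tp_Ÿ̲̲` by part II and
squares to `1` on `Δ^tp_Y̲̲`, whence `H2`). Consequences for any `RigidData` over the model (abc-iut-L2-t8's `rigidData`):
`prop214_ii_of_model` (+ `_of_odd`, `_of_double`, `_of_torsionfree`), `cor218_ii_of_model`.

HONEST FRAMING: [EtTh] is refereed; these are OUR kernel checks of printed reductions, conditional on
the named §1 facts as stated; no side is taken on [IUTchIII] Cor 3.12.
-/

noncomputable section

namespace Literature.AnabelianGeometry.EtaleTheta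

open Literature.AnabelianGeometry.SemiGraphs
open scoped IsMulCommutative

/-! ## The §1 model -/

namespace ThetaSetting

namespace EtaleThetaData.DoubleUnderline

variable {p : ℕ} [Fact p.Prime] {D : ThetaSetting p} {E : D.EtaleThetaData} {l : ℕ}
  (C : E.DoubleUnderline l) {N : ℕ+} (μ : D.CyclotomeMod l N)

/-- `Π^tp_Y̲̲ ↠ G_K` (already `Π^tp_Ÿ̲̲ ↠ G_K`, `map_aug_Ydduu`). [cite: MochizukiEtTh2009, Prop 2.2 (iii) p.37] -/
theorem augY_surjective (hC : D.Compat) (hS : D.Sec2Hyps) :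
    Function.Surjective (C.thetaEnvData μ hC hS).augY := by
  intro γ
  have hmem : (γ : GQp p) ∈ (D.GtpYdd ⊓ C.Huu).map D.aug.toMonoidHom := by
    rw [C.map_aug_Ydduu]; exact γ.2
  obtain ⟨k, hk, hkγ⟩ := hmem
  exact ⟨⟨⟨k, hk.2⟩, D.GtpYdd_le_GtpY hk.1⟩, Subtype.ext hkγ⟩

/-- **`hgal` for the §1 model** (the `Gal(Y/X)`-generator extension of [EtTh] Prop 2.14 (ii), p.49):
for every theta cocycle `η` of abc-iut-L2-t8's `thetaEnvData` and every `x ∈ Π^tp_X̲̲`, the difference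
cocycle `η · (x·η)⁻¹` on `Π^tp_Ÿ̲̲` extends to a continuous cocycle `ρ` of `Π^tp_Y̲̲` whose shift normalises
`D_Y`. From t1's `Prop15iii` + `Prop15ii` (Prop 1.5 (ii), (iii), as cited in print), `K = K̈`, `l` odd,
`Δ_Θ` central, and the explicit hypothesis `H2` (the `2`-torsion of `l·Δ_Θ` dies in `μ_N`).
[cite: MochizukiEtTh2009, Prop 2.14(ii) p.49] -/
theorem thetaEnvData_gal_extension (hC : D.Compat) (hS : D.Sec2Hyps) (h15 : Prop15iii E hC)
    (h15ii : Prop15ii E.toKummerData hC) (H2 : ∀ t : D.lDeltaTheta l, t ^ 2 = 1 → μ.red t = 1) :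
    ∀ (η : (C.thetaEnvData μ hC hS).PiYdd → (C.thetaEnvData μ hC hS).mu)
      (_ : η ∈ (C.thetaEnvData μ hC hS).thetaCocycles) (x : (C.thetaEnvData μ hC hS).PiX),
      ∃ (ρ : (C.thetaEnvData μ hC hS).PiY → (C.thetaEnvData μ hC hS).mu)
        (hρ : CycEnvelope.IsEnvCocycle (C.thetaEnvData μ hC hS).augY (C.thetaEnvData μ hC hS).chi ρ)
        (hc : CycEnvelope.shift hρ ∈ contMulAut (C.thetaEnvData μ hC hS).env),
        (∀ g : (C.thetaEnvData μ hC hS).PiYdd, ρ ((C.thetaEnvData μ hC hS).inclYdd g) =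
          η g * ((C.thetaEnvData μ hC hS).chi ((C.thetaEnvData μ hC hS).aug x) (η ⟨x⁻¹ * g * x, by
            simpa [mul_assoc] using (C.thetaEnvData μ hC hS).PiYdd_normal.conj_mem _ g.2 x⁻¹⟩))⁻¹) ∧
        (C.thetaEnvData μ hC hS).DY.map (MulAut.conj (TopOut.mk _ ⟨_, hc⟩)).toMonoidHom =
          (C.thetaEnvData μ hC hS).DY := by
  set T := C.thetaEnvData μ hC hS with hT
  haveI := C.GtpYuu_normal
  intro η hη x
  obtain ⟨f, hf, rfl⟩ := hη
  obtain ⟨b, kk, m, e, hm, hrep⟩ := C.exists_descended_rep hC hS h15 hf x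
  -- the descended extension `F = m(·̄) · ∂e(·̄)` on `Π^tp_Y̲̲`
  set F : contCocycles (D.toTheta.comp C.Huu.subtype) D.DeltaTheta (D.GtpY.subgroupOf C.Huu) :=
    ContH1.inflCocycle D.DeltaTheta (D.toTheta.comp C.Huu.subtype) C.continuous_toTheta_comp_subtype
        C.map_GtpYuu_le m *
      ⟨_, C.cob_mem_contCocycles e⟩ with hFdef
  have hFm : ∀ g : D.GtpY.subgroupOf C.Huu, F.1 g =
      m.1 ⟨D.toTheta ((g : C.Huu) : D.PiTemp), C.map_GtpYuu_le ⟨(g : C.Huu), g.2, rfl⟩⟩ *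
        (MulAut.conjNormal (D.toTheta ((g : C.Huu) : D.PiTemp)) e * e⁻¹) := fun g => rfl
  clear_value F
  -- `F` restricts to `f · (x·f)⁻¹` on `Π^tp_Ÿ̲̲`
  have hFres : ∀ k : D.GtpYdd.subgroupOf C.Huu,
      F.1 (Subgroup.inclusion (H := D.GtpYdd.subgroupOf C.Huu) (K := D.GtpY.subgroupOf C.Huu)
        (Subgroup.comap_mono D.GtpYdd_le_GtpY) k) =
        f.1 (C.inclYdduu k) * (MulAut.conjNormal (D.toTheta (x : D.PiTemp))
          (f.1 ⟨(x : D.PiTemp)⁻¹ * (C.inclYdduu k : C.GtpYdduu) * x,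
            C.inv_mul_mul_mem_GtpYdduu hC x (C.inclYdduu k)⟩))⁻¹ := by
    intro k
    rw [hFm]
    exact (hrep (C.inclYdduu k)).symm
  -- hence `F` is `l·Δ_Θ`-valued
  have hFl : ∀ g, (F.1 g : D.GtpTheta) ∈ D.lDeltaTheta l := by
    refine C.lDelta_valued_of_restrict hC hS μ F fun k => ?_
    rw [hFres, Subgroup.coe_mul, Subgroup.coe_inv]
    exact mul_mem (hf.1 _) (inv_mem ((D.lDeltaTheta_normal l).conj_mem _ (hf.1 _) _))
  -- `ρ := red ∘ F`
  refine ⟨fun g => μ.red ⟨(F.1 g : D.GtpTheta), hFl g⟩, ?_, ?_, ?_, ?_⟩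
  · -- cocycle identity
    intro g h
    change μ.red ⟨(F.1 (g * h) : D.GtpTheta), hFl _⟩ =
      μ.red ⟨(F.1 g : D.GtpTheta), hFl g⟩ *
        galMuN p N (D.aug.toMonoidHom ((g : C.Huu) : D.PiTemp)) (μ.red ⟨(F.1 h : D.GtpTheta), hFl h⟩)
    rw [← μ.red_conj, ← map_mul]
    congr 1
    apply Subtype.ext
    change ((F.1 (g * h) : D.DeltaTheta) : D.GtpTheta) = _
    rw [F.2.2 g h, Subgroup.coe_mul, MulAut.conjNormal_apply]
    rfl
  · -- bi-continuity of the shift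
    refine T.shift_mem_contMulAut_of_continuous _ ?_
    exact μ.continuous_red.comp (Continuous.subtype_mk (continuous_subtype_val.comp F.2.1) _)
  · -- restriction to `Π^tp_Ÿ̲̲`
    intro g
    have hval : ((F.1 (Subgroup.inclusion (H := D.GtpYdd.subgroupOf C.Huu)
        (K := D.GtpY.subgroupOf C.Huu) (Subgroup.comap_mono D.GtpYdd_le_GtpY) g) : D.DeltaTheta) :
          D.GtpTheta) =
        (f.1 (C.inclYdduu g) : D.GtpTheta) *
          ((MulAut.conjNormal (D.toTheta (x : D.PiTemp))
            (f.1 ⟨(x : D.PiTemp)⁻¹ * (C.inclYdduu g : C.GtpYdduu) * x,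
              C.inv_mul_mul_mem_GtpYdduu hC x (C.inclYdduu g)⟩) : D.DeltaTheta) : D.GtpTheta)⁻¹ := by
      rw [hFres g, Subgroup.coe_mul, Subgroup.coe_inv]
    change μ.red ⟨(F.1 (Subgroup.inclusion (H := D.GtpYdd.subgroupOf C.Huu)
        (K := D.GtpY.subgroupOf C.Huu) (Subgroup.comap_mono D.GtpYdd_le_GtpY) g) : D.GtpTheta), _⟩ =
      C.modN μ f hf.1 g * (galMuN p N (D.aug.toMonoidHom (x : D.PiTemp))
        (C.modN μ f hf.1 ⟨x⁻¹ * (g : C.Huu) * x, _⟩))⁻¹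
    unfold modN
    rw [← μ.red_conj, ← map_inv μ.red, ← map_mul μ.red]
    congr 1
    apply Subtype.ext
    simp only [Subgroup.coe_mul, Subgroup.coe_inv]
    exact hval
  · -- `α_ρ` normalises `D_Y`
    refine T.DY_map_conj_shift_eq _ _ fun y => ?_
    -- the cocycle `(y·F)·F⁻¹` on `Π^tp_Y̲̲` and its reduction `(y·ρ)·ρ⁻¹`
    set ψ := ContH1.conjCocycle (D.toTheta.comp C.Huu.subtype) D.DeltaTheta (y : C.Huu) F * F⁻¹
      with hψdef
    have hψl : ∀ g, (ψ.1 g : D.GtpTheta) ∈ D.lDeltaTheta l := by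
      intro g
      change (((ContH1.conjCocycle (D.toTheta.comp C.Huu.subtype) D.DeltaTheta (y : C.Huu) F).1 g *
        (F.1 g)⁻¹ : D.DeltaTheta) : D.GtpTheta) ∈ D.lDeltaTheta l
      rw [ContH1.conjCocycle_apply, Subgroup.coe_mul, Subgroup.coe_inv, MulAut.conjNormal_apply]
      exact mul_mem ((D.lDeltaTheta_normal l).conj_mem _ (hFl _) _) (inv_mem (hFl g))
    have hΦ : ((fun g : T.PiY => T.chi (T.aug y) (μ.red ⟨(F.1 ⟨y⁻¹ * g * y, by
          simpa [mul_assoc] using T.PiY_normal.conj_mem _ g.2 y⁻¹⟩ : D.GtpTheta), hFl _⟩)) *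
        (fun g => μ.red ⟨(F.1 g : D.GtpTheta), hFl g⟩)⁻¹) =
        fun g => μ.red ⟨(ψ.1 g : D.GtpTheta), hψl g⟩ := by
      funext g
      simp only [Pi.mul_apply, Pi.inv_apply]
      change galMuN p N (D.aug.toMonoidHom ((y : C.Huu) : D.PiTemp)) _ * _ = _
      rw [← μ.red_conj, ← map_inv μ.red, ← map_mul μ.red]
      congr 1
      apply Subtype.ext
      simp only [Subgroup.coe_mul, Subgroup.coe_inv]
      change _ = (((ContH1.conjCocycle (D.toTheta.comp C.Huu.subtype) D.DeltaTheta (y : C.Huu) F).1 g *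
        (F.1 g)⁻¹ : D.DeltaTheta) : D.GtpTheta)
      have h1 : (((ContH1.conjCocycle (D.toTheta.comp C.Huu.subtype) D.DeltaTheta (y : C.Huu) F).1 g :
          D.DeltaTheta) : D.GtpTheta) =
          D.toTheta (y : D.PiTemp) * ((F.1 ⟨y⁻¹ * g * y, by
            simpa [mul_assoc] using T.PiY_normal.conj_mem _ g.2 y⁻¹⟩ : D.DeltaTheta) : D.GtpTheta) *
            (D.toTheta (y : D.PiTemp))⁻¹ := by
        rw [ContH1.conjCocycle_apply_eq ((y : C.Huu)) F g ⟨y⁻¹ * g * y, by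
            simpa [mul_assoc] using T.PiY_normal.conj_mem _ g.2 y⁻¹⟩ rfl, MulAut.conjNormal_apply]
        rfl
      simp only [Subgroup.coe_mul, Subgroup.coe_inv, h1]
    rw [hΦ]
    refine T.exists_factor_of_apply_ker (C.augY_surjective μ hC hS) ?_ ?_
    · -- cocycle identity of `red ∘ ψ`
      intro g h
      change μ.red ⟨(ψ.1 (g * h) : D.GtpTheta), hψl _⟩ =
        μ.red ⟨(ψ.1 g : D.GtpTheta), hψl g⟩ *
          galMuN p N (D.aug.toMonoidHom ((g : C.Huu) : D.PiTemp)) (μ.red ⟨(ψ.1 h : D.GtpTheta), hψl h⟩)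
      rw [← μ.red_conj, ← map_mul]
      congr 1
      apply Subtype.ext
      change ((ψ.1 (g * h) : D.DeltaTheta) : D.GtpTheta) = _
      rw [ψ.2.2 g h, Subgroup.coe_mul, MulAut.conjNormal_apply]
      rfl
    · -- vanishing on `Δ^tp_Y̲̲`: `ψ(d)² = ψ(d²) = 1` and `H2`
      intro d hd
      have hd' : D.aug.toMonoidHom ((d : C.Huu) : D.PiTemp) = 1 := congrArg Subtype.val hd
      apply H2
      apply Subtype.ext
      change ((ψ.1 d : D.DeltaTheta) : D.GtpTheta) ^ 2 = 1
      have hdd : D.aug.toMonoidHom (((d * d : D.GtpY.subgroupOf C.Huu) : C.Huu) : D.PiTemp) = 1 := by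
        change D.aug.toMonoidHom (((d : C.Huu) : D.PiTemp) * ((d : C.Huu) : D.PiTemp)) = 1
        rw [map_mul, hd', mul_one]
      have h1 : ψ.1 (d * d) = 1 :=
        C.conjDiff_apply_eq_one_of_mem hC h15 h15ii b kk m hm e F hFm y (d * d) hdd
          (C.mul_self_mem_GtpYdd hC hS μ d)
      rw [pow_two, ← Subgroup.coe_mul, ← C.cocycle_apply_mul_self_of_aug_eq_one ψ d hd', h1]
      rfl

/-- `H2` holds when `N` is odd: an element of `μ_N` killed by `2` and by `N` is trivial.
[cite: MochizukiEtTh2009, Prop 2.14(ii) p.49] -/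
theorem red_eq_one_of_sq_eq_one_of_odd (hN : Odd (N : ℕ)) (t : D.lDeltaTheta l) (ht : t ^ 2 = 1) :
    μ.red t = 1 := by
  have h2 : orderOf (μ.red t) ∣ 2 := orderOf_dvd_of_pow_eq_one (by rw [← map_pow, ht, map_one])
  have hN' : orderOf (μ.red t) ∣ (N : ℕ) := by
    have hc := pow_card_eq_one (G := MuN p N) (x := μ.red t)
    rw [card_MuN] at hc
    exact orderOf_dvd_of_pow_eq_one hc
  have hcop : Nat.Coprime 2 (N : ℕ) := Nat.coprime_two_left.2 hN
  have h1 : orderOf (μ.red t) ∣ Nat.gcd 2 (N : ℕ) := Nat.dvd_gcd h2 hN'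
  rw [hcop.gcd_eq_one, Nat.dvd_one] at h1
  exact orderOf_eq_one_iff.1 h1

/-- `H2` holds when `Δ_Θ` has no `2`-torsion (e.g. `Δ_Θ ≅ Ẑ(1)`, p.12).
[cite: MochizukiEtTh2009, §1 p.12] -/
theorem red_eq_one_of_sq_eq_one_of_torsionfree (hΔ : ∀ t ∈ D.DeltaTheta, t ^ 2 = 1 → t = 1)
    (t : D.lDeltaTheta l) (ht : t ^ 2 = 1) : μ.red t = 1 := by
  have : t = 1 := by
    apply Subtype.ext
    exact hΔ _ (D.lDeltaTheta_le l t.2) (by rw [← Subgroup.coe_pow, ht]; rfl)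
  rw [this, map_one]

/-- `H2` at level `N` holds as soon as the cyclotome is also given compatibly at level `2N`
(`red_N = (red_{2N})²`, i.e. `Δ_Θ ≅ Ẑ(1)` level-wise at the two levels `N ∣ 2N`, p.12; cf. abc-iut-L2-t8's
`CyclotomeTower`): `t² = 1` gives `red_N(t) = red_{2N}(t²) = 1`. [cite: MochizukiEtTh2009, §1 p.12] -/
theorem red_eq_one_of_sq_eq_one_of_double (μ₂ : D.CyclotomeMod l (2 * N))
    (hcompat : ∀ t : D.lDeltaTheta l,
      ((μ.red t : MuN p N) : (PadicAlgCl p)ˣ) = ((μ₂.red t : MuN p (2 * N)) : (PadicAlgCl p)ˣ) ^ 2)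
    (t : D.lDeltaTheta l) (ht : t ^ 2 = 1) : μ.red t = 1 := by
  have h2 : μ₂.red t ^ 2 = 1 := by rw [← map_pow, ht, map_one]
  apply Subtype.ext
  have h3 : ((μ₂.red t : MuN p (2 * N)) : (PadicAlgCl p)ˣ) ^ 2 =
      ((μ₂.red t ^ 2 : MuN p (2 * N)) : (PadicAlgCl p)ˣ) := rfl
  rw [hcompat, h3, h2]
  rfl

/-- **[EtTh] Prop 2.14 (ii) for the §1 model**, for any `RigidData` whose underlying `ThetaEnvData` is
abc-iut-L2-t8's `thetaEnvData` (e.g. its `rigidData`): conditional on t1's `Prop15ii`, `Prop15iii`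
(Prop 1.5 (ii), (iii), as the printed proof) and `H2`. [cite: MochizukiEtTh2009, Prop 2.14(ii) p.49] -/
theorem prop214_ii_of_model (hC : D.Compat) (hS : D.Sec2Hyps) (h15 : Prop15iii E hC)
    (h15ii : Prop15ii E.toKummerData hC) (H2 : ∀ t : D.lDeltaTheta l, t ^ 2 = 1 → μ.red t = 1)
    (R : RigidData.{0} N l) (hR : R.toThetaEnvData = C.thetaEnvData μ hC hS) : R.Prop214_ii := by
  obtain ⟨T₀, thetaKer, thetaKer_normal, thetaKer_le, lDeltaTheta, thetaKer_le_lDeltaTheta,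
    lDeltaTheta_le, lDeltaTheta_normal, thetaMod, thetaMod_surjective, thetaMod_ker, thetaMod_conj,
    cocycle_thetaKer, cocycle_lDeltaTheta, cuspY, cuspX, cuspX_neg, augYdd_surjective,
    thetaSections_conj⟩ := R
  subst hR
  exact RigidData.prop214_ii_of_gal_extension _ (C.thetaEnvData_gal_extension μ hC hS h15 h15ii H2)

/-- **[EtTh] Cor 2.18 (ii) for the §1 model** (via `cor218_ii_of_prop214_ii`,
`Discharge/Sec2RigidityProofs.lean`), under the same hypotheses. [cite: MochizukiEtTh2009, Cor 2.18(ii) p.59] -/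
theorem cor218_ii_of_model (hC : D.Compat) (hS : D.Sec2Hyps) (h15 : Prop15iii E hC)
    (h15ii : Prop15ii E.toKummerData hC) (H2 : ∀ t : D.lDeltaTheta l, t ^ 2 = 1 → μ.red t = 1)
    (R : RigidData.{0} N l) (hR : R.toThetaEnvData = C.thetaEnvData μ hC hS) : R.Cor218_ii :=
  R.cor218_ii_of_prop214_ii (C.prop214_ii_of_model μ hC hS h15 h15ii H2 R hR)

/-- Prop 2.14 (ii) for the model at ODD level `N`, conditional only on Prop 1.5 (ii), (iii).
[cite: MochizukiEtTh2009, Prop 2.14(ii) p.49] -/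
theorem prop214_ii_of_model_of_odd (hC : D.Compat) (hS : D.Sec2Hyps) (h15 : Prop15iii E hC)
    (h15ii : Prop15ii E.toKummerData hC) (hN : Odd (N : ℕ))
    (R : RigidData.{0} N l) (hR : R.toThetaEnvData = C.thetaEnvData μ hC hS) : R.Prop214_ii :=
  C.prop214_ii_of_model μ hC hS h15 h15ii (red_eq_one_of_sq_eq_one_of_odd μ hN) R hR

/-- Prop 2.14 (ii) for the model given the cyclotome compatibly at levels `N` and `2N` (abc-iut-L2-t8's
`CyclotomeTower` supplies this), conditional only on Prop 1.5 (ii), (iii).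
[cite: MochizukiEtTh2009, Prop 2.14(ii) p.49] -/
theorem prop214_ii_of_model_of_double (hC : D.Compat) (hS : D.Sec2Hyps) (h15 : Prop15iii E hC)
    (h15ii : Prop15ii E.toKummerData hC) (μ₂ : D.CyclotomeMod l (2 * N))
    (hcompat : ∀ t : D.lDeltaTheta l,
      ((μ.red t : MuN p N) : (PadicAlgCl p)ˣ) = ((μ₂.red t : MuN p (2 * N)) : (PadicAlgCl p)ˣ) ^ 2)
    (R : RigidData.{0} N l) (hR : R.toThetaEnvData = C.thetaEnvData μ hC hS) : R.Prop214_ii :=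
  C.prop214_ii_of_model μ hC hS h15 h15ii (red_eq_one_of_sq_eq_one_of_double μ μ₂ hcompat) R hR

/-- Prop 2.14 (ii) for the model when `Δ_Θ` has no `2`-torsion (`Δ_Θ ≅ Ẑ(1)`), conditional only on
Prop 1.5 (ii), (iii). [cite: MochizukiEtTh2009, Prop 2.14(ii) p.49] -/
theorem prop214_ii_of_model_of_torsionfree (hC : D.Compat) (hS : D.Sec2Hyps) (h15 : Prop15iii E hC)
    (h15ii : Prop15ii E.toKummerData hC) (hΔ : ∀ t ∈ D.DeltaTheta, t ^ 2 = 1 → t = 1)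
    (R : RigidData.{0} N l) (hR : R.toThetaEnvData = C.thetaEnvData μ hC hS) : R.Prop214_ii :=
  C.prop214_ii_of_model μ hC hS h15 h15ii (red_eq_one_of_sq_eq_one_of_torsionfree μ hΔ) R hR

end EtaleThetaData.DoubleUnderline

end ThetaSetting

end Literature.AnabelianGeometry.EtaleTheta

end
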